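import Summits.AtomisticToContinuum.Crystallization.Theorems.SpectralChargeLedgerShellsToLayersTemplateSlots
import Summits.AtomisticToContinuum.Crystallization.Theorems.GappedShellCensusCleanLimitsHaveWindowsLayered

/-!
# `SpectralChargeLedger.ShellsToLayers` (stmt-AtomisticToContinuum-17254), line `blowup-slot-layering` —
# stub S3 `stub_exactSlotLayering`: exact template shells everywhere ⇒ exactly layered at spacing `a₀`

Helper file for the crux `ShellsToLayers` of route `SpectralChargeLedger` (supports
stmt-AtomisticToContinuum-17254; proves the registered stub `stub_exactSlotLayering` of the line
`Cruxes/ShellsToLayers/Lines/blowup_slot_layering.lean` verbatim — the line's C⁺, its longest stub).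

A non-empty `Z ⊆ ℝ³` every point of which has an EXACT template shell at scale `(a₀, h₀)` (its punctured
open `13/10·a₀`-shell is `p + A(template)` for the hcp or the fcc template, pointwise) is a translate of a
rigid image of a layered Barlow-type set `{i u + j v + haggLabel s m · w + z m · e₃}` at in-plane spacing
EXACTLY `a₀`, with a Hägg word `s` and increments `z (m+1) − z m ∈ [39a₀/50, 17a₀/20]`. This is the landed
chain of crux 15932 (`CleanHull.stub_firstLayer → stub_layerStepUp / stub_layerStepDown →
stub_layeredOfExactShells`, Theorems/GappedShellCensusCleanLimitsHaveWindowsLayered*.lean) read at `a := a₀`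
through the slot dictionary (`stub_templateShells`), re-run so as to KEEP the step band and to PIN the spacing:

* `laSlot_of_exactShell` — an exact template shell is a rotated slot model `range (p + A (laSlot t a₀ h₀ h₀ ·))`;
* `shell_band_of_laSlot`, `bondShell_eq_of_laSlot` — then all shell points are at distance in
  `[0.98a₀, 1.02a₀]` and the `CleanHull.bondShell a₀` of the site IS that slot model;
* `cleanHull_hyps_of_exactShell` — hence the hypotheses `hgap ∧ hexact` of the `CleanHull` chain at `a := a₀`
  (gap: nothing else below `1.3a₀ ≥ 1.26a₀`), with parameters `(a₀, h₀, h₀)` at every site;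
* `firstLayer_spacing` — a first complete triangular layer at spacing exactly `a₀` (`la_walk` in the plane of
  a rigid site with `inplaneStep_of_type`, or `stub_cuboctStep` when every site is cubic at the ideal ratio);
* `stub_exactSlotLayering` — the `ℤ`-recursion over `stub_layerStepUp/Down` from that layer, keeping the band,
  the Hägg word read off the layer labels, every point covered (heights grow linearly).

All `[folklore]` (Hales DSP 2012 §1.3: layer structure of the close packings). No definitions.
-/

noncomputable section

namespace Summit.AtomisticToContinuum.Crystallization.Theorems.ShellsToLayers

open Literature.MathematicalPhysics.StatisticalMechanics
open Summit.AtomisticToContinuum.Crystallization.Theorems.CleanHull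

/-- An exact template shell, read through the dictionary `stub_templateShells`: the punctured open
`13/10·a₀`-shell of `p` is the rotated slot model of one of the two types, translated to `p`. [folklore] -/
theorem laSlot_of_exactShell {a₀ h₀ : ℝ} (ha : 47 / 50 ≤ a₀) (hh : |h₀ - a₀ * Real.sqrt (2 / 3)| ≤ a₀ / 100)
    {Z : Set (EuclideanSpace ℝ (Fin 3))} {p : EuclideanSpace ℝ (Fin 3)}
    (h : (∃ A : EuclideanSpace ℝ (Fin 3) →ₗᵢ[ℝ] EuclideanSpace ℝ (Fin 3),
        {z : EuclideanSpace ℝ (Fin 3) | z ∈ Z ∧ z ≠ p ∧ dist z p < 13 / 10 * a₀} =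
            (fun q => p + A q) '' {q : EuclideanSpace ℝ (Fin 3) | q ∈ hcpStacking a₀ h₀ ∧ q ≠ 0 ∧ ‖q‖ < 13 / 10 * a₀} ∨
          {z : EuclideanSpace ℝ (Fin 3) | z ∈ Z ∧ z ≠ p ∧ dist z p < 13 / 10 * a₀} =
            (fun q => p + A q) '' {q : EuclideanSpace ℝ (Fin 3) | q ∈ fccStacking a₀ h₀ ∧ q ≠ 0 ∧ ‖q‖ < 13 / 10 * a₀})) :
    ∃ (A : EuclideanSpace ℝ (Fin 3) →ₗᵢ[ℝ] EuclideanSpace ℝ (Fin 3)) (t : Bool),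
      {z : EuclideanSpace ℝ (Fin 3) | z ∈ Z ∧ z ≠ p ∧ dist z p < 13 / 10 * a₀} =
        Set.range fun k : Fin 12 => p + A (laSlot t a₀ h₀ h₀ k) := by
  obtain ⟨hH, hC⟩ := stub_templateShells a₀ h₀ ha hh
  obtain ⟨A, h | h⟩ := h
  · rw [hH] at h
    exact ⟨A, false, by rw [h, ← Set.range_comp]; rfl⟩
  · rw [hC] at h
    exact ⟨A, true, by rw [h, ← Set.range_comp]; rfl⟩

/-- At a site whose shell is a rotated slot model, every other point of `Z` within `13/10·a₀` is at distance in
the radial band `[0.98a₀, 1.02a₀]` (`laSlot_norm_band`). [folklore] -/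
theorem shell_band_of_laSlot {a₀ h₀ : ℝ} (ha : 47 / 50 ≤ a₀) (hh : |h₀ - a₀ * Real.sqrt (2 / 3)| ≤ a₀ / 100)
    {Z : Set (EuclideanSpace ℝ (Fin 3))} {p : EuclideanSpace ℝ (Fin 3)}
    {A : EuclideanSpace ℝ (Fin 3) →ₗᵢ[ℝ] EuclideanSpace ℝ (Fin 3)} {t : Bool}
    (hA : {z : EuclideanSpace ℝ (Fin 3) | z ∈ Z ∧ z ≠ p ∧ dist z p < 13 / 10 * a₀} =
      Set.range fun k : Fin 12 => p + A (laSlot t a₀ h₀ h₀ k))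
    {w : EuclideanSpace ℝ (Fin 3)} (hw : w ∈ Z) (hwp : w ≠ p) (hd : dist w p < 13 / 10 * a₀) :
    a₀ * (1 - 1 / 50) ≤ dist p w ∧ dist p w ≤ a₀ * (1 + 1 / 50) := by
  have hw' : w ∈ {z : EuclideanSpace ℝ (Fin 3) | z ∈ Z ∧ z ≠ p ∧ dist z p < 13 / 10 * a₀} := ⟨hw, hwp, hd⟩
  rw [hA] at hw'
  obtain ⟨k, rfl⟩ := hw'
  have : dist p (p + A (laSlot t a₀ h₀ h₀ k)) = ‖laSlot t a₀ h₀ h₀ k‖ := by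
    rw [dist_eq_norm]; simp
  rw [this]
  exact laSlot_norm_band ha hh t k

/-- At such a site the `CleanHull.bondShell a₀` (points at distance `≤ 1.02a₀`) IS the slot model. [folklore] -/
theorem bondShell_eq_of_laSlot {a₀ h₀ : ℝ} (ha : 47 / 50 ≤ a₀) (hh : |h₀ - a₀ * Real.sqrt (2 / 3)| ≤ a₀ / 100)
    {Z : Set (EuclideanSpace ℝ (Fin 3))} {p : EuclideanSpace ℝ (Fin 3)}
    {A : EuclideanSpace ℝ (Fin 3) →ₗᵢ[ℝ] EuclideanSpace ℝ (Fin 3)} {t : Bool}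
    (hA : {z : EuclideanSpace ℝ (Fin 3) | z ∈ Z ∧ z ≠ p ∧ dist z p < 13 / 10 * a₀} =
      Set.range fun k : Fin 12 => p + A (laSlot t a₀ h₀ h₀ k)) :
    bondShell a₀ Z p = Set.range fun k : Fin 12 => p + A (laSlot t a₀ h₀ h₀ k) := by
  obtain ⟨ha0, -, -⟩ := inBox_bounds ha hh
  rw [← hA]
  ext w
  simp only [bondShell, Set.mem_setOf_eq]
  constructor
  · rintro ⟨hw, hwp, hd⟩
    refine ⟨hw, hwp, ?_⟩
    rw [dist_comm]; nlinarith
  · rintro ⟨hw, hwp, hd⟩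
    exact ⟨hw, hwp, (shell_band_of_laSlot ha hh hA hw hwp hd).2⟩

/-- **Dictionary into the landed chain.** Exact template shells everywhere give, at scale `a := a₀`, the gap
clause `hgap` and the exact-slot clause `hexact` of `CleanHull.stub_firstLayer / stub_layerStepUp /
stub_layerStepDown`. [folklore] -/
theorem cleanHull_hyps_of_exactShell {a₀ h₀ : ℝ} (ha : 47 / 50 ≤ a₀)
    (hh : |h₀ - a₀ * Real.sqrt (2 / 3)| ≤ a₀ / 100) {Z : Set (EuclideanSpace ℝ (Fin 3))}
    (hZ : ∀ p ∈ Z, (∃ A : EuclideanSpace ℝ (Fin 3) →ₗᵢ[ℝ] EuclideanSpace ℝ (Fin 3),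
        {z : EuclideanSpace ℝ (Fin 3) | z ∈ Z ∧ z ≠ p ∧ dist z p < 13 / 10 * a₀} =
            (fun q => p + A q) '' {q : EuclideanSpace ℝ (Fin 3) | q ∈ hcpStacking a₀ h₀ ∧ q ≠ 0 ∧ ‖q‖ < 13 / 10 * a₀} ∨
          {z : EuclideanSpace ℝ (Fin 3) | z ∈ Z ∧ z ≠ p ∧ dist z p < 13 / 10 * a₀} =
            (fun q => p + A q) '' {q : EuclideanSpace ℝ (Fin 3) | q ∈ fccStacking a₀ h₀ ∧ q ≠ 0 ∧ ‖q‖ < 13 / 10 * a₀})) :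
    (∀ y ∈ Z, ∀ w ∈ Z, w ≠ y → a₀ * (1 - 1 / 50) ≤ dist y w ∧
      (dist y w ≤ a₀ * (1 + 1 / 50) ∨ a₀ * (63 / 50) ≤ dist y w)) ∧
    (∀ p ∈ Z, ∃ (a' hp' hm' : ℝ) (A : EuclideanSpace ℝ (Fin 3) →ₗᵢ[ℝ] EuclideanSpace ℝ (Fin 3)),
      0 < a' ∧ 0 < hp' ∧ 0 < hm' ∧
      ((bondShell a₀ Z p = Set.range fun k : Fin 12 => p + A (slotC a' hp' hm' k)) ∨
       (bondShell a₀ Z p = Set.range fun k : Fin 12 => p + A (slotH a' hp' hm' k)))) := by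
  obtain ⟨ha0, hlo, -⟩ := inBox_bounds ha hh
  have hh0 : 0 < h₀ := by linarith
  refine ⟨fun y hy w hw hwy => ?_, fun p hp => ?_⟩
  · obtain ⟨A, t, hA⟩ := laSlot_of_exactShell ha hh (hZ y hy)
    by_cases hd : dist w y < 13 / 10 * a₀
    · obtain ⟨h1, h2⟩ := shell_band_of_laSlot ha hh hA hw hwy hd
      exact ⟨h1, Or.inl h2⟩
    · push Not at hd
      rw [dist_comm] at hd
      exact ⟨by nlinarith, Or.inr (by nlinarith)⟩
  · obtain ⟨A, t, hA⟩ := laSlot_of_exactShell ha hh (hZ p hp)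
    have hbond := bondShell_eq_of_laSlot ha hh hA
    refine ⟨a₀, h₀, h₀, A, ha0, hh0, hh0, ?_⟩
    cases t
    · exact Or.inr (by rw [hbond]; rfl)
    · exact Or.inl (by rw [hbond]; rfl)

/-- **First complete layer at spacing exactly `a₀`.** Re-export of `CleanHull.stub_firstLayer` with the slot
representations supplied by the exact `(a₀, h₀)`-shells, so that the in-plane spacing of the layer is `a₀`
itself: walk in the plane of a rigid site (hexagonal type, or any type off the ideal ratio) with
`inplaneStep_of_type`, or — every site cubic at the ideal ratio — with `stub_cuboctStep`. [folklore] -/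
theorem firstLayer_spacing {a₀ h₀ : ℝ} (ha : 47 / 50 ≤ a₀) (hh : |h₀ - a₀ * Real.sqrt (2 / 3)| ≤ a₀ / 100)
    {Z : Set (EuclideanSpace ℝ (Fin 3))} (hne : Z.Nonempty)
    (hZ : ∀ p ∈ Z, (∃ A : EuclideanSpace ℝ (Fin 3) →ₗᵢ[ℝ] EuclideanSpace ℝ (Fin 3),
        {z : EuclideanSpace ℝ (Fin 3) | z ∈ Z ∧ z ≠ p ∧ dist z p < 13 / 10 * a₀} =
            (fun q => p + A q) '' {q : EuclideanSpace ℝ (Fin 3) | q ∈ hcpStacking a₀ h₀ ∧ q ≠ 0 ∧ ‖q‖ < 13 / 10 * a₀} ∨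
          {z : EuclideanSpace ℝ (Fin 3) | z ∈ Z ∧ z ≠ p ∧ dist z p < 13 / 10 * a₀} =
            (fun q => p + A q) '' {q : EuclideanSpace ℝ (Fin 3) | q ∈ fccStacking a₀ h₀ ∧ q ≠ 0 ∧ ‖q‖ < 13 / 10 * a₀})) :
    ∃ p₀ ∈ Z, ∃ A : EuclideanSpace ℝ (Fin 3) →ₗᵢ[ℝ] EuclideanSpace ℝ (Fin 3),
      ∀ i j : ℤ, A ((i : ℝ) • triangularVec₁ a₀ + (j : ℝ) • triangularVec₂ a₀) + p₀ ∈ Z := by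
  obtain ⟨ha0, hlo, -⟩ := inBox_bounds ha hh
  have hh0 : 0 < h₀ := by linarith
  obtain ⟨hgap, hexact⟩ := cleanHull_hyps_of_exactShell ha hh hZ
  have rep : ∀ p ∈ Z, ∃ (A : EuclideanSpace ℝ (Fin 3) →ₗᵢ[ℝ] EuclideanSpace ℝ (Fin 3)) (t : Bool),
      bondShell a₀ Z p = Set.range (fun k : Fin 12 => p + A (laSlot t a₀ h₀ h₀ k)) := by
    intro p hp
    obtain ⟨A, t, hA⟩ := laSlot_of_exactShell ha hh (hZ p hp)
    exact ⟨A, t, bondShell_eq_of_laSlot ha hh hA⟩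
  by_cases hid : 3 * h₀ ^ 2 = 2 * a₀ ^ 2
  · by_cases hex : ∃ y ∈ Z, ∃ B : EuclideanSpace ℝ (Fin 3) →ₗᵢ[ℝ] EuclideanSpace ℝ (Fin 3),
        bondShell a₀ Z y = Set.range (fun k : Fin 12 => y + B (laSlot false a₀ h₀ h₀ k))
    · -- a hexagonal site is rigid: walk in its plane
      obtain ⟨y, hy, B, hS⟩ := hex
      refine ⟨y, hy, B, fun i j => ?_⟩
      rw [add_comm]
      exact la_walk Z a₀ a₀ h₀ h₀ ha0 false
        (fun x F hx hFx => inplaneStep_of_type Z a₀ ha0 hgap hexact x hx a₀ h₀ h₀ F ha0 hh0 hh0 false hFx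
          (fun h => absurd h Bool.false_ne_true)) B y hy hS i j
    · -- every site is a perfect cuboctahedron: walk with the cuboctahedral step
      have hall : ∀ y ∈ Z, ∃ (b k : ℝ) (B : EuclideanSpace ℝ (Fin 3) →ₗᵢ[ℝ] EuclideanSpace ℝ (Fin 3)),
          0 < b ∧ 0 < k ∧ 3 * k ^ 2 = 2 * b ^ 2 ∧
          bondShell a₀ Z y = Set.range fun i : Fin 12 => y + B (slotC b k k i) := by
        intro y hy
        obtain ⟨B, t, hS⟩ := rep y hy
        cases t
        · exact absurd ⟨y, hy, B, hS⟩ hex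
        · exact ⟨a₀, h₀, B, ha0, hh0, hid, hS⟩
      obtain ⟨y, hy⟩ := hne
      obtain ⟨B', t', hS'⟩ := rep y hy
      cases t'
      · exact absurd ⟨y, hy, B', hS'⟩ hex
      · refine ⟨y, hy, B', fun i j => ?_⟩
        rw [add_comm]
        exact la_walk Z a₀ a₀ h₀ h₀ ha0 true
          (fun x F hx hFx => stub_cuboctStep Z a₀ ha0 hall x hx a₀ h₀ F ha0 hh0 hid hFx) B' y hy hS' i j
  · -- off the ideal ratio every site is rigid
    obtain ⟨y, hy⟩ := hne
    obtain ⟨B, t, hS⟩ := rep y hy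
    refine ⟨y, hy, B, fun i j => ?_⟩
    rw [add_comm]
    exact la_walk Z a₀ a₀ h₀ h₀ ha0 t
      (fun x F hx hFx => inplaneStep_of_type Z a₀ ha0 hgap hexact x hx a₀ h₀ h₀ F ha0 hh0 hh0 t hFx
        (fun _ h2 => hid h2.1)) B y hy hS i j

/-- **Stub S3 of the line `blowup-slot-layering` (registered signature, verbatim): exact template shells
everywhere ⇒ exactly layered at spacing `a₀` with banded increments.** The `ℤ`-recursion of
`CleanHull.stub_layeredOfExactShells` re-run from `firstLayer_spacing` (spacing `a₀`) KEEPING the step band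
`39/50·a₀ ≤ h ≤ 17/20·a₀` of `stub_layerStepUp/Down`. [folklore] -/
theorem stub_exactSlotLayering : ∀ (a₀ h₀ : ℝ), 47 / 50 ≤ a₀ → a₀ ≤ 1 → |h₀ - a₀ * Real.sqrt (2 / 3)| ≤ a₀ / 100 → ∀ (Z : Set (EuclideanSpace ℝ (Fin 3))), Z.Nonempty → (∀ p ∈ Z, (∃ A : EuclideanSpace ℝ (Fin 3) →ₗᵢ[ℝ] EuclideanSpace ℝ (Fin 3), {z : EuclideanSpace ℝ (Fin 3) | z ∈ Z ∧ z ≠ p ∧ dist z p < 13 / 10 * a₀} = (fun q => p + A q) '' {q : EuclideanSpace ℝ (Fin 3) | q ∈ Literature.MathematicalPhysics.StatisticalMechanics.hcpStacking a₀ h₀ ∧ q ≠ 0 ∧ ‖q‖ < 13 / 10 * a₀} ∨ {z : EuclideanSpace ℝ (Fin 3) | z ∈ Z ∧ z ≠ p ∧ dist z p < 13 / 10 * a₀} = (fun q => p + A q) '' {q : EuclideanSpace ℝ (Fin 3) | q ∈ Literature.MathematicalPhysics.StatisticalMechanics.fccStacking a₀ h₀ ∧ q ≠ 0 ∧ ‖q‖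 < 13 / 10 * a₀})) → (∃ (A : EuclideanSpace ℝ (Fin 3) →ₗᵢ[ℝ] EuclideanSpace ℝ (Fin 3)) (s : ℤ → ℤ) (z : ℤ → ℝ) (v : EuclideanSpace ℝ (Fin 3)), Literature.MathematicalPhysics.StatisticalMechanics.IsHaggSeq s ∧ (∀ m : ℤ, 39 / 50 * a₀ ≤ z (m + 1) - z m ∧ z (m + 1) - z m ≤ 17 / 20 * a₀) ∧ Z = (fun q => q + v) '' {q : EuclideanSpace ℝ (Fin 3) | ∃ m i j : ℤ, q = A (((i : ℝ) • Literature.MathematicalPhysics.StatisticalMechanics.triangularVec₁ a₀) + ((j : ℝ) • Literature.MathematicalPhysics.StatisticalMechanics.triangularVec₂ a₀) + ((Literature.MathematicalPhysics.StatisticalMechanics.haggLabel s m : ℝ) • Literature.MathematicalPhysics.StatisticalMechanics.barlowOffset a₀) + (z m • Literature.MathematicalPhysics.StatisticalMechanics.layerNormal 1))}) := by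
  classical
  intro a₀ h₀ ha _ hh Z hne hZ
  obtain ⟨ha0, -, -⟩ := inBox_bounds ha hh
  obtain ⟨hgap, hexact⟩ := cleanHull_hyps_of_exactShell ha hh hZ
  obtain ⟨p₀, -, A, hL0⟩ := firstLayer_spacing ha hh hne hZ
  have hlo : a₀ * (1 - 1 / 50) ≤ a₀ := by linarith
  have hhi : a₀ ≤ a₀ * (1 + 1 / 50) := by linarith
  -- layer points and heights
  let pt : ℤ → ℝ → ℤ → ℤ → EuclideanSpace ℝ (Fin 3) := fun L z i j =>
    A (((i : ℝ) • triangularVec₁ a₀) + ((j : ℝ) • triangularVec₂ a₀) + ((L : ℝ) • barlowOffset a₀) +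
      (z • layerNormal 1)) + p₀
  let ht : EuclideanSpace ℝ (Fin 3) → ℝ := fun x => inner ℝ (x - p₀) (A (layerNormal 1))
  -- one step up / down, as functions on complete layers, keeping the band
  have hup : ∀ q : {Lz : ℤ × ℝ // ∀ i j : ℤ, pt Lz.1 Lz.2 i j ∈ Z},
      ∃ q' : {Lz : ℤ × ℝ // ∀ i j : ℤ, pt Lz.1 Lz.2 i j ∈ Z},
        (q'.1.1 - q.1.1 = 1 ∨ q'.1.1 - q.1.1 = -1) ∧ 39 / 50 * a₀ ≤ q'.1.2 - q.1.2 ∧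
        q'.1.2 - q.1.2 ≤ 17 / 20 * a₀ ∧
        ∀ x ∈ Z, q.1.2 ≤ ht x → ht x < q'.1.2 → ∃ i j : ℤ, x = pt q.1.1 q.1.2 i j := by
    rintro ⟨⟨L, z⟩, hLz⟩
    obtain ⟨ε, h, hε, hlo', hhi', hnext, hexa⟩ :=
      stub_layerStepUp Z a₀ ha0 hgap hexact p₀ a₀ A hlo hhi L z hLz
    refine ⟨⟨(L + ε, z + h), hnext⟩, ?_, ?_, ?_, ?_⟩
    · simpa using hε
    · show 39 / 50 * a₀ ≤ z + h - z
      linarith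
    · show z + h - z ≤ 17 / 20 * a₀
      linarith
    · intro x hx h1 h2
      exact hexa x hx h1 h2
  have hdown : ∀ q : {Lz : ℤ × ℝ // ∀ i j : ℤ, pt Lz.1 Lz.2 i j ∈ Z},
      ∃ q' : {Lz : ℤ × ℝ // ∀ i j : ℤ, pt Lz.1 Lz.2 i j ∈ Z},
        (q.1.1 - q'.1.1 = 1 ∨ q.1.1 - q'.1.1 = -1) ∧ 39 / 50 * a₀ ≤ q.1.2 - q'.1.2 ∧
        q.1.2 - q'.1.2 ≤ 17 / 20 * a₀ ∧
        ∀ x ∈ Z, q'.1.2 ≤ ht x → ht x < q.1.2 → ∃ i j : ℤ, x = pt q'.1.1 q'.1.2 i j := by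
    rintro ⟨⟨L, z⟩, hLz⟩
    obtain ⟨ε, h, hε, hlo', hhi', hnext, hexa⟩ :=
      stub_layerStepDown Z a₀ ha0 hgap hexact p₀ a₀ A hlo hhi L z hLz
    refine ⟨⟨(L + ε, z - h), hnext⟩, ?_, ?_, ?_, ?_⟩
    · rcases hε with rfl | rfl <;> simp
    · show 39 / 50 * a₀ ≤ z - (z - h)
      linarith
    · show z - (z - h) ≤ 17 / 20 * a₀
      linarith
    · intro x hx h1 h2
      exact hexa x hx h1 h2
  choose F hF1 hF2 hF2' hF3 using hup
  choose G hG1 hG2 hG2' hG3 using hdown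
  have h00 : ∀ i j : ℤ, pt 0 0 i j ∈ Z := by
    intro i j
    have := hL0 i j
    simpa [pt] using this
  let q0 : {Lz : ℤ × ℝ // ∀ i j : ℤ, pt Lz.1 Lz.2 i j ∈ Z} := ⟨(0, 0), h00⟩
  let U : ℕ → {Lz : ℤ × ℝ // ∀ i j : ℤ, pt Lz.1 Lz.2 i j ∈ Z} := fun n => F^[n] q0
  let D : ℕ → {Lz : ℤ × ℝ // ∀ i j : ℤ, pt Lz.1 Lz.2 i j ∈ Z} := fun n => G^[n] q0
  let LZ : ℤ → ℤ × ℝ := fun m => Int.rec (fun n => (U n).1) (fun n => (D (n + 1)).1) m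
  have hU : ∀ n : ℕ, U (n + 1) = F (U n) := fun n => Function.iterate_succ_apply' F n q0
  have hD : ∀ n : ℕ, D (n + 1) = G (D n) := fun n => Function.iterate_succ_apply' G n q0
  have hLZ_neg : ∀ n : ℕ, LZ (Int.negSucc n) = (D (n + 1)).1 := fun n => rfl
  -- every layer lies in `Z`
  have hmem : ∀ m i j : ℤ, pt (LZ m).1 (LZ m).2 i j ∈ Z := by
    intro m i j
    cases m with
    | ofNat n => exact (U n).2 i j
    | negSucc n => exact (D (n + 1)).2 i j
  -- consecutive layers
  have hstep : ∀ m : ℤ, ((LZ (m + 1)).1 - (LZ m).1 = 1 ∨ (LZ (m + 1)).1 - (LZ m).1 = -1) ∧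
      (39 / 50 * a₀ ≤ (LZ (m + 1)).2 - (LZ m).2 ∧ (LZ (m + 1)).2 - (LZ m).2 ≤ 17 / 20 * a₀) ∧
      ∀ x ∈ Z, (LZ m).2 ≤ ht x → ht x < (LZ (m + 1)).2 → ∃ i j : ℤ, x = pt (LZ m).1 (LZ m).2 i j := by
    intro m
    cases m with
    | ofNat n =>
      have e0 : LZ (Int.ofNat n) = (U n).1 := rfl
      have e1 : LZ (Int.ofNat n + 1) = (F (U n)).1 := by
        rw [← hU n]; rfl
      rw [e0, e1]
      exact ⟨hF1 (U n), ⟨hF2 (U n), hF2' (U n)⟩, hF3 (U n)⟩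
    | negSucc n =>
      cases n with
      | zero =>
        have e0 : LZ (Int.negSucc 0) = (G q0).1 := by
          rw [hLZ_neg 0, hD 0]; rfl
        have e1 : LZ (Int.negSucc 0 + 1) = q0.1 := rfl
        rw [e0, e1]
        exact ⟨hG1 q0, ⟨hG2 q0, hG2' q0⟩, hG3 q0⟩
      | succ k =>
        have e0 : LZ (Int.negSucc (k + 1)) = (G (D (k + 1))).1 := by
          rw [hLZ_neg (k + 1), hD (k + 1)]
        have e1 : LZ (Int.negSucc (k + 1) + 1) = (D (k + 1)).1 := by
          rw [show Int.negSucc (k + 1) + 1 = Int.negSucc k by rfl, hLZ_neg k]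
        rw [e0, e1]
        exact ⟨hG1 (D (k + 1)), ⟨hG2 (D (k + 1)), hG2' (D (k + 1))⟩, hG3 (D (k + 1))⟩
  -- the Hägg word, the heights, the labels
  let s : ℤ → ℤ := fun m => (LZ (m + 1)).1 - (LZ m).1
  let zf : ℤ → ℝ := fun m => (LZ m).2
  have hHagg : IsHaggSeq s := fun m => (hstep m).1
  have hc : 0 < 39 / 50 * a₀ := by positivity
  have hband : ∀ m : ℤ, 39 / 50 * a₀ ≤ zf (m + 1) - zf m ∧ zf (m + 1) - zf m ≤ 17 / 20 * a₀ :=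
    fun m => (hstep m).2.1
  have hlabel : ∀ m : ℤ, haggLabel s m = (LZ m).1 := by
    intro m
    induction m using Int.induction_on with
    | zero => rw [haggLabel_zero]; rfl
    | succ n ih =>
      rw [haggLabel_succ, ih]
      show (LZ (n : ℤ)).1 + ((LZ ((n : ℤ) + 1)).1 - (LZ (n : ℤ)).1) = (LZ ((n : ℤ) + 1)).1
      omega
    | pred n ih =>
      have h1 := haggLabel_succ s (-(n : ℤ) - 1)
      rw [show -(n : ℤ) - 1 + 1 = -n by ring, ih] at h1
      have : s (-(n : ℤ) - 1) = (LZ (-n)).1 - (LZ (-(n : ℤ) - 1)).1 := by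
        show (LZ (-(n : ℤ) - 1 + 1)).1 - (LZ (-(n : ℤ) - 1)).1 = _
        rw [show -(n : ℤ) - 1 + 1 = -n by ring]
      omega
  -- heights grow at least linearly
  have hgrow : ∀ (m : ℤ) (k : ℕ), zf m + 39 / 50 * a₀ * k ≤ zf (m + k) := by
    intro m k
    induction k with
    | zero => simp
    | succ k ih =>
      have := (hstep (m + k)).2.1.1
      have e : m + ((k + 1 : ℕ) : ℤ) = m + k + 1 := by push_cast; ring
      rw [e]
      push_cast
      linarith
  -- every point of `Z` lies on a layer
  have hcover : ∀ x ∈ Z, ∃ m i j : ℤ, x = pt (LZ m).1 (LZ m).2 i j := by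
    intro x hx
    have hbdd : ∃ b : ℤ, ∀ m : ℤ, zf m ≤ ht x → m ≤ b := by
      obtain ⟨N, hN⟩ := exists_nat_gt ((ht x - zf 0) / (39 / 50 * a₀))
      refine ⟨N, fun m hm => ?_⟩
      by_contra hlt
      push Not at hlt
      obtain ⟨k, rfl⟩ := Int.eq_ofNat_of_zero_le (show (0 : ℤ) ≤ m by omega)
      have hg := hgrow 0 k
      rw [zero_add] at hg
      have hkN : (N : ℝ) < k := by exact_mod_cast (show (N : ℤ) < k from hlt)
      have h2 : (ht x - zf 0) / (39 / 50 * a₀) < k := hN.trans hkN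
      rw [div_lt_iff₀ hc] at h2
      linarith
    have hinh : ∃ m : ℤ, zf m ≤ ht x := by
      obtain ⟨N, hN⟩ := exists_nat_gt ((zf 0 - ht x) / (39 / 50 * a₀))
      refine ⟨-(N : ℤ), ?_⟩
      have hg := hgrow (-(N : ℤ)) N
      rw [show -(N : ℤ) + N = 0 by ring] at hg
      rw [div_lt_iff₀ hc] at hN
      linarith
    obtain ⟨m, hm1, hm2⟩ := Int.exists_greatest_of_bdd hbdd hinh
    have hlt : ht x < zf (m + 1) := by
      by_contra hle
      push Not at hle
      have := hm2 (m + 1) hle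
      omega
    obtain ⟨i, j, hxij⟩ := (hstep m).2.2 x hx hm1 hlt
    exact ⟨m, i, j, hxij⟩
  -- read off
  refine ⟨A, s, zf, p₀, hHagg, hband, ?_⟩
  ext x
  simp only [Set.mem_image, Set.mem_setOf_eq]
  constructor
  · intro hx
    obtain ⟨m, i, j, rfl⟩ := hcover x hx
    exact ⟨_, ⟨m, i, j, rfl⟩, by rw [hlabel m]⟩
  · rintro ⟨_, ⟨m, i, j, rfl⟩, rfl⟩
    rw [hlabel m]
    exact hmem m i j

end Summit.AtomisticToContinuum.Crystallization.Theorems.ShellsToLayers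

end
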